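import Summits.QuantumFields.YangMills.Theorems.FluctuationComparisonRegPrIntLOrganTangentModeLettersFromHeight
import Summits.QuantumFields.YangMills.Theorems.FluctuationComparisonRegPrIntLOrganTangentModeSectionKnit
import HarnessLib

/-!
# `FluctuationComparisonRegPrIntLOrganTangentModeSectionOfUniqMax` — (L10) «MODE∘ ⟸ UNIQ-MAX∘ ALONE, FROM A HEIGHT»: the composition of LEAD w3 g23's MODE∘ knit
# ✓`…OrganTangentModeSectionKnit.modeSection_of_uniqueFibreMax` with ✓(L9) `…ModeLettersFromHeight.exists_height_modeLetters` — the chart letters and the window-continuity of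
# `descend` are discharged; what remains of row MODE∘ (LINE g26-1 «mode_section») is the one-well letter UNIQ-MAX∘ and the frame's `ContinuousOn r′`

Cell `ym3-torus` (rung R3 = continuum `SU(2)` Yang–Mills on T³ — NOT d = 4, NOT infinite volume, NOT a mass gap, NOT Clay), width seat `ym-ust-20520-w5` (gen 21), pen (L10)
(LEAD w3 g23 WORD №12 (i) «yours or mine — say»; w5: MINE).  `--kind proof --supports stmt-QuantumFields-20520 --as helper`, count-neutral, definition-free, default heartbeats;
ONE THEOREM; nothing printed is asserted.

★★★ `exists_height_modeSection_of_uniqueFibreMax`: for every `F : T3Family`, `0 < γ ≤ 1`, `0 < b₀` and every `p₀` there is a height `jM` such that for all `j ≥ jM`, for every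
`r′` continuous on the `θ_{j+1}`-window and satisfying UNIQ-MAX∘ at height `j` (the `hmax` text of the knit VERBATIM), the MODE∘ conclusion holds (the knit's `∃ Us, …` text
VERBATIM).  NOT HERE: UNIQ-MAX∘; the E2E to the `ModeSectionCan` row text; MODE∘∕TRM∘∕LIN∘∕JEN∘∕O1∕crux 20520∕`YM3TorusSU2` are NOT proved.  No `def`, `instance`, `sorry`.
-/

set_option autoImplicit false

noncomputable section

namespace Summit.QuantumFields.YangMills.Theorems.FluctuationComparisonRegPrIntLOrganTangentModeSectionOfUniqMax

open Set Function Filter Topology MeasureTheory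
open Literature.MathematicalPhysics.QuantumFieldTheory.Balaban1983to89
open Literature.MathematicalPhysics.QuantumFieldTheory.Balaban1983to89.T3OrbitAverage
open T3ContinuumYM3Torus T3NestedUnitLaws T3UnitLawDensityEML T3UnitScaleTilt T3LevelShift T4Continuum AveragingRT BlockAveraging
open Literature.MathematicalPhysics.QuantumFieldTheory.Balaban1983to89.BlockAveragingHaarAC (centralBond)
open Summit.QuantumFields.YangMills.Theorems.FluctuationComparisonRegPrIntLOrganTangentModeLettersFromHeight (exists_height_modeLetters)
open Summit.QuantumFields.YangMills.Theorems.OrganTangentModeSectionKnit (modeSection_of_uniqueFibreMax)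

/-- ★★★ **MODE∘ ⟸ UNIQ-MAX∘ ALONE, FROM A HEIGHT** (see the module docstring). [cite: Balaban1987RG1, (0.4) p.253 and (2.10) p.267; Balaban1985UV3, (42)-(44) p.266] -/
theorem exists_height_modeSection_of_uniqueFibreMax
    (F : T3Family) (γ b₀ p₀ : ℝ) (hγ : 0 < γ) (hγ1 : γ ≤ 1) (hb₀ : 0 < b₀) :
    ∃ jM : ℕ, ∀ (j : ℕ), jM ≤ j →
      ∀ (r' : GaugeField (F.P (j + 1)) 0 ↥(Matrix.specialUnitaryGroup (Fin 2) ℂ) → ℝ),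
        ContinuousOn r' {U | PlaqSmall (θBal F.L γ b₀ p₀ (j + 1)) U} →
        ( ∀ V : GaugeField (F.P j) 0 ↥(Matrix.specialUnitaryGroup (Fin 2) ℂ), PlaqSmall (θBal F.L γ b₀ p₀ j) V →
      ∃ Ustar : GaugeField (F.P (j + 1)) 0 ↥(Matrix.specialUnitaryGroup (Fin 2) ℂ),
        descend F ℰp j Ustar = V ∧ PlaqSmall (θBal F.L γ b₀ p₀ (j + 1) / 2) Ustar ∧
        (∀ U, descend F ℰp j U = V → PlaqSmall (θBal F.L γ b₀ p₀ (j + 1)) U → r' U ≤ r' Ustar) ∧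
        (∀ U, descend F ℰp j U = V → PlaqSmall (θBal F.L γ b₀ p₀ (j + 1)) U → r' Ustar ≤ r' U → U = Ustar)) →
    ∃ Us : GaugeField (F.P j) 0 ↥(Matrix.specialUnitaryGroup (Fin 2) ℂ) → GaugeField (F.P (j + 1)) 0 ↥(Matrix.specialUnitaryGroup (Fin 2) ℂ),
      ContinuousOn Us {V | PlaqSmall (θBal F.L γ b₀ p₀ j) V} ∧
      (∀ V, PlaqSmall (θBal F.L γ b₀ p₀ j) V → descend F ℰp j (Us V) = V ∧ PlaqSmall (θBal F.L γ b₀ p₀ (j + 1) / 2) (Us V) ∧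
        ∀ U, descend F ℰp j U = V → PlaqSmall (θBal F.L γ b₀ p₀ (j + 1)) U → r' U ≤ r' (Us V)) := by
  obtain ⟨jB, hB⟩ := exists_height_modeLetters F γ b₀ p₀ hγ hγ1 hb₀
  refine ⟨jB, fun j hj r' hr' hmax => ?_⟩
  obtain ⟨hdc, T, θ, hTo, hθc, hright, hsol⟩ := hB j hj
  exact modeSection_of_uniqueFibreMax F γ b₀ p₀ j
    (T3MinimiserStabilityReduction.θBal_pos (by have := F.hL.2; omega) hγ hγ1 hb₀ p₀ (j + 1)) r' hr' hdc T θ hTo hθc hright hsol hmax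

end Summit.QuantumFields.YangMills.Theorems.FluctuationComparisonRegPrIntLOrganTangentModeSectionOfUniqMax

end
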